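import Literature.NumberTheory.LFunctions.ZetaZeroSumsLehmanLimits
import HarnessLib

/-!
# RH-FREE — The harmonic constant `H = lim_{T→∞} (Σ_{0<γ≤T} 1/γ − log²(T/2π)/(4π))` over the zeros of `ζ`: Brent–Platt–Trudgian, Bull. Aust. Math. Soc. 104 (2021), Theorem 1 "the limit exists" PROVED with `H = ∫_{2π}^∞ Q/t² − 1/(16π)`; Lemma 1; Lemma 2 / Theorem 2 (the accelerated formula, `|E₂(T)| ≤ (4.27 + 0.12 log T)/T²`); eq. (2.10) («nothing here bears on the truth of RH»)

Topic `Literature/NumberTheory/LFunctions` (RH literature-typing tranche 1, L4 "explicit zero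
statistics", gen 7). Label: **RH-FREE** — unconditional statements about the ordinates `γ` of the
non-trivial zeros of `ζ`. ONE definition with a body (`zetaZeroHarmonicLimit`, the constant `H`
written in the closed form the source PROVES equal to the limit) and THEOREMS; NO new named fact;
standard axioms. Nothing here bears on the truth of RH.

Source: R. P. Brent, D. J. Platt, T. S. Trudgian, *A harmonic sum over nontrivial zeros of the
Riemann zeta-function*, Bull. Aust. Math. Soc. 104 (2021) 59–65 = arXiv:2009.05251
`[corpus:paper:arxiv-2009.05251 p0004 (Thm 1 with proof), p0005 (Lemmas 1–2), p0006 (Thm 2, Cor 1,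
eq. (2.10))]`. With `G(T) = Σ_{0<γ≤T} 1/γ` (multiplicities), `N = L + Q`,
`L(T) = (T/2π)(log(T/2π) − 1) + 7/8` (the tree's `countMain`), `S₁`, and Trudgian's `A₀ = 2.067`,
`A₁ = 0.059`. The general engine (the Math. Comp. companion paper's Theorems 1–3 for a test
function `φ`) is `ZetaZeroSumsLehmanLimits.lean`; this file is its instance `φ(t) = 1/t`, `T₀ = 2π`.

## What is here

* `zetaZeroHarmonicLimit` — the constant **`H := ∫_{2π}^∞ Q(t)/t² dt − 1/(16π)`** (DEFINITION with a
  body; the integrand is integrable: `integrableOn_count_sub_countMain_div_sq`).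
* `BrentPlattTrudgian2021BAMS_thm1_tendsto` — **Theorem 1: "The limit `H` in (1.1) exists. Also,
  `H = ∫_{2π}^∞ Q(t)/t² dt − 1/(16π)`"**, PROVED: `G(T) − log²(T/2π)/(4π) → zetaZeroHarmonicLimit`
  (`γ₁ > 2π`: `BPT2021.zerosBetween_zero_two_pi`; `Q(2π) = 1/8`: `BPT2021.count_sub_countMain_two_pi`).
* `BrentPlattTrudgian2021BAMS_thm1_iff` — hence the tree's NAMED FACT `BrentPlattTrudgian2021BAMS_thm1`
  (`ZetaZeroSumsLehmanExplicit.lean`: "`∃ H`, `|H − H₀| ≤ 10⁻¹⁸` and `G(T) − log²/4π → H`",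
  `H₀ = BPT2021.H = −0.0171594043070981495`) is EQUIVALENT to the bare numerical enclosure
  `|zetaZeroHarmonicLimit − H₀| ≤ 10⁻¹⁸` — Corollary 1, an interval computation with `10¹⁰` zeros,
  not replayed here (limits in `ℝ` are unique).
* `BrentPlattTrudgian2021BAMS_lemma1` — **Lemma 1**:
  `∫_{2π}^T Q/t² = G(T) − Q(T)/T + 1/(16π) − log²(T/2π)/(4π)` (`T ≥ 2π`).
* `BrentPlattTrudgian2021BAMS_thm2_eq` — **Theorem 2, eq. (2.11), as an exact identity** for every
  `T ≥ 2π`: `H = Σ_{0<γ≤T} (1/γ − 1/T) − (log²(T/2πe) + 1)/(4π) + 7/(8T) + E₂(T)`, `E₂(T) = ∫_T^∞ Q/t²`.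
* `BrentPlattTrudgian2021BAMS_lemma2`, `BrentPlattTrudgian2021BAMS_thm2` — **Lemma 2 / Theorem 2 with
  the printed bound `|E₂(T)| ≤ (4.27 + 0.12 log T)/T²`** (`T ≥ 2π`), MODULO the two named facts the
  printed proof rests on: the standing condition (1.4)=(2.9) `|S₁(T) − c| ≤ A₀ + A₁ log T` on `[2π, ∞)`
  (`BrentPlattTrudgian2021_eq29`: Trudgian 2011 for `T > 168π` — a tree theorem — plus "a small
  computation shows that (1.4) also holds for `T ∈ [2π,168π]`") and `|Q − S| ≤ 1/(150T)`
  (`BrentPlattTrudgian2021_lemma2`; the BAMS text uses Trudgian 2014's `Q = S + 0.2ϑ/T`, which gives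
  the same printed `4.27`, `0.12`: `2A₀ + 0.5A₁ + 0.1 + 2A₁ log T`). A version with NO named fact
  (`|E₂(T)| ≤ (2.508 + 0.059 log T)/T²` for `T > 168π`, from the tree's Turing-method theorem, a
  `native_decide` certificate) is in the companion file `ZetaZeroHarmonicLimitNumerics.lean`.
* `abs_sum_inv_ordinate_sub_log_sq_sub_harmonicLimit_le_of_count` — **eq. (2.10)**:
  `|G(T) − log²(T/2π)/(4π) − H| ≤ A(2 log T + 1)/T` for `T ≥ 2π` whenever `|N − L| ≤ A log t` on
  `[2π, ∞)` ("follows from Lehman"; the source states it for `T ≥ 2πe` with `A = 0.28`); the instance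
  `BrentPlattTrudgian2022_cor1.abs_sum_inv_sub_log_sq_sub_harmonicLimit_le` (`A = 0.28` = the named
  fact BPT 2022, Cor. 1), and `BrentPlattTrudgian2021BAMS_thm1.abs_sum_inv_sub_log_sq_sub_H_le`:
  `G(T) = log²(T/2π)/(4π) − 0.0171594043070981495 + ϑ(10⁻¹⁸ + 0.28(2 log T + 1)/T)` from the two facts.

Compare the tree's fact-free `|G(T) − log²(T/2π)/(4π)| ≤ 0.9321` (Saouter–Trudgian–Demichel 2015,
Lemma 2.10, `ZetaZeroHarmonicSumTwoSided.lean`): the present file identifies the limit and the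
`O(log T/T)`, `O(log T/T²)` rates. The source notes that `H < 0` "is significant in the proof of"
Brent–Platt–Trudgian 2022 (the mean square of `ψ(x) − x`); a kernel enclosure of `H` from the tree's
certified zeros is left to the companion numerics file. Deliberately NOT here: Cor. 1's value
(`10¹⁰` zeros), Table 1, §5.

## References

* R. P. Brent, D. J. Platt, T. S. Trudgian, Bull. Aust. Math. Soc. 104 (2021) 59–65, Thm 1,
  Lemmas 1–2, Thm 2 (2.11), Cor 1, eq. (2.10). [BrentPlattTrudgian2021BAMS]
* R. P. Brent, D. J. Platt, T. S. Trudgian, Math. Comp. 90 (2021) 2923–2935, Thm 1 (1.3)–(1.4),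
  Lemma 2. [BrentPlattTrudgian2021]
* R. P. Brent, D. J. Platt, T. S. Trudgian, J. Number Theory 238 (2022) 740–762, Cor. 1.
  [BrentPlattTrudgian2022]
-/

noncomputable section

open Filter Set MeasureTheory intervalIntegral
open scoped Real Topology

namespace Literature.NumberTheory.LFunctions

open SchoenfeldBound

/-! ## The harmonic sum `Σ_{0<γ≤T} 1/γ` and the constant `H` (Brent–Platt–Trudgian, Bull. Aust. Math. Soc. 2021) -/

/-- **The Brent–Platt–Trudgian constant `H`**, DEFINED by the closed expression of their
Theorem 1: `H := ∫_{2π}^∞ Q(t)/t² dt − 1/(16π)`, `Q = N − L` (`zetaZeroCount − countMain`).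
That it IS the limit `lim_{T→∞} (Σ_{0<γ≤T} 1/γ − log²(T/2π)/(4π))` is the theorem
`BrentPlattTrudgian2021BAMS_thm1_tendsto` below; its value `−0.0171594043070981495 + ϑ(10⁻¹⁸)`
(their Cor. 1, `10¹⁰` zeros) is the content of the named fact `BrentPlattTrudgian2021BAMS_thm1`
(`ZetaZeroSumsLehmanExplicit.lean`), see `BrentPlattTrudgian2021BAMS_thm1_iff`.
[cite: BrentPlattTrudgian2021BAMS, Theorem 1] -/
def zetaZeroHarmonicLimit : ℝ :=
  (∫ t in Ioi (2 * π), ((zetaZeroCount t : ℝ) - countMain t) / t ^ 2) - 1 / (16 * π)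

/-- There are no zeros with `0 < γ ≤ 2π` (`γ₁ > 14 > 2π`). [cite: BrentPlattTrudgian2021BAMS, §2 ("γ₁ > 2π")] -/
theorem BPT2021.zerosBetween_zero_two_pi : zerosBetween 0 (2 * π) = ∅ := by
  have hπ : π < 3.15 := Real.pi_lt_d2
  ext ρ
  simp only [Finset.notMem_empty, iff_false]
  intro hρ
  obtain ⟨hz, -, -, h3, h4⟩ := (mem_zerosBetween le_rfl).1 hρ
  exact riemannZeta_ne_zero_of_im_pos_of_im_le_fourteen h3 (by linarith) hz

/-- `Σ_{0<γ≤T} f = Σ_{2π<γ≤T} f` for `T ≥ 2π`. [cite: BrentPlattTrudgian2021BAMS, §2 ("γ₁ > 2π")] -/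
theorem BPT2021.sum_zerosBetween_zero_eq {T : ℝ} (hT : 2 * π ≤ T) (f : ℂ → ℝ) :
    ∑ ρ ∈ zerosBetween 0 T, f ρ = ∑ ρ ∈ zerosBetween (2 * π) T, f ρ := by
  rw [SoundTest.sum_zerosBetween_split le_rfl (by positivity) hT f, BPT2021.zerosBetween_zero_two_pi,
    Finset.sum_empty, zero_add]

/-- `N(2π) = 0`. [cite: BrentPlattTrudgian2021BAMS, §2 ("γ₁ > 2π")] -/
theorem BPT2021.zetaZeroCount_two_pi : zetaZeroCount (2 * π) = 0 := by
  have hπ : π < 3.15 := Real.pi_lt_d2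
  have h := zetaZeroCount_mono (show 2 * π ≤ 14 by linarith)
  rw [zetaZeroCount_fourteen] at h
  exact Nat.le_zero.1 h

/-- `L(2π) = −1/8`, so `Q(2π) = N(2π) − L(2π) = 1/8`. [cite: BrentPlattTrudgian2021BAMS, Theorem 1 (proof: "Q(2π) = 1/8")] -/
theorem BPT2021.count_sub_countMain_two_pi : (zetaZeroCount (2 * π) : ℝ) - countMain (2 * π) = 1 / 8 := by
  rw [BPT2021.zetaZeroCount_two_pi, countMain, div_self (by positivity : (2 : ℝ) * π ≠ 0), Real.log_one]
  norm_num

/-- `Q(t)/t²` is integrable on `(T, ∞)` for every `T ≥ 3`. [cite: BrentPlattTrudgian2021BAMS, Theorem 1 (proof: "the last integral converges")] -/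
theorem integrableOn_count_sub_countMain_div_sq {T : ℝ} (hT : 3 ≤ T) :
    IntegrableOn (fun t ↦ ((zetaZeroCount t : ℝ) - countMain t) / t ^ 2) (Ioi T) := by
  have h0 : 0 < T := by linarith
  have h := BPT2021.integrableOn_count_sub_countMain_mul_deriv hT (BPT2021.hasDerivAt_one_div h0)
    (BPT2021.continuousOn_neg_one_div_sq h0) (fun t ht ↦ by have := h0.trans_le ht; positivity)
    (fun t ht ↦ by
      have := h0.trans_le ht
      exact div_nonpos_of_nonpos_of_nonneg (by norm_num) (by positivity))
    (BPT2021.integrableOn_one_div_div h0)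
  refine (h.neg).congr_fun (fun t ht ↦ ?_) measurableSet_Ioi
  have ht0 : 0 < t := h0.trans ht
  show -(((zetaZeroCount t : ℝ) - countMain t) * (-1 / t ^ 2)) = ((zetaZeroCount t : ℝ) - countMain t) / t ^ 2
  field_simp

/-- `∫_T^∞ Q(t)·(−1/t²) dt = −∫_T^∞ Q(t)/t² dt` (`E₂` of the BAMS paper vs. `−∫φ'Q` of the
Math. Comp. paper for `φ(t) = 1/t`). [cite: BrentPlattTrudgian2021BAMS, Lemma 2 eq. (2.5)] -/
theorem BPT2021.integral_Ioi_mul_neg_one_div_sq (T : ℝ) :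
    ∫ t in Ioi T, ((zetaZeroCount t : ℝ) - countMain t) * (-1 / t ^ 2) =
      -∫ t in Ioi T, ((zetaZeroCount t : ℝ) - countMain t) / t ^ 2 := by
  rw [← MeasureTheory.integral_neg]
  refine setIntegral_congr_fun measurableSet_Ioi fun t _ ↦ ?_
  ring

/-- **Brent–Platt–Trudgian 2021 (Bull. Aust. Math. Soc.), Theorem 1 — "The limit `H` exists"**,
PROVED: `Σ_{0<γ≤T} m(ρ)/γ − log²(T/2π)/(4π) → H = ∫_{2π}^∞ Q/t² − 1/(16π)` as `T → ∞`
(Stieltjes integration against `N = L + Q`, `Q(2π) = 1/8`, `Q ≪ log t`). Unconditional; uses only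
the tree's proved `|N − L| ≤ 0.3083 log t + 3.253`. [cite: BrentPlattTrudgian2021BAMS, Theorem 1] -/
theorem BrentPlattTrudgian2021BAMS_thm1_tendsto :
    Tendsto (fun T : ℝ ↦ ∑ ρ ∈ zerosBetween 0 T, (riemannZetaZeroOrder ρ : ℝ) / ρ.im
        - Real.log (T / (2 * π)) ^ 2 / (4 * π)) atTop (𝓝 zetaZeroHarmonicLimit) := by
  have hπ : 3 < π := Real.pi_gt_three
  have h0 : (0 : ℝ) < 2 * π := by positivity
  have h2 : (3 : ℝ) ≤ 2 * π := by linarith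
  have h := BrentPlattTrudgian2021_thm2 h2 (BPT2021.hasDerivAt_one_div h0)
    (BPT2021.continuousOn_neg_one_div_sq h0) (fun t ht ↦ by have := h0.trans_le ht; positivity)
    (fun t ht ↦ by
      have := h0.trans_le ht
      exact div_nonpos_of_nonpos_of_nonneg (by norm_num) (by positivity))
    (BPT2021.integrableOn_one_div_div h0)
  rw [BPT2021.count_sub_countMain_two_pi, BPT2021.integral_Ioi_mul_neg_one_div_sq] at h
  have e : -(1 / (2 * π) * (1 / 8 : ℝ))
      - -∫ t in Ioi (2 * π), ((zetaZeroCount t : ℝ) - countMain t) / t ^ 2 = zetaZeroHarmonicLimit := by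
    rw [zetaZeroHarmonicLimit]
    ring
  rw [e] at h
  refine h.congr' ?_
  filter_upwards [eventually_ge_atTop (2 * π)] with T hT
  rw [integral_inv_mul_log h0 hT, div_self h0.ne', Real.log_one, BPT2021.sum_zerosBetween_zero_eq hT]
  have e2 : ∑ ρ ∈ zerosBetween (2 * π) T, (riemannZetaZeroOrder ρ : ℝ) * (1 / ρ.im) =
      ∑ ρ ∈ zerosBetween (2 * π) T, (riemannZetaZeroOrder ρ : ℝ) / ρ.im :=
    Finset.sum_congr rfl fun ρ _ ↦ by rw [mul_one_div]
  rw [e2]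
  field_simp
  ring

/-- The named fact `BrentPlattTrudgian2021BAMS_thm1` (existence of the limit AND its 18-digit
value) is, given the theorem above, exactly the numerical enclosure
`|H − (−0.0171594043070981495)| ≤ 10⁻¹⁸` of the defined constant (limits in `ℝ` are unique).
[cite: BrentPlattTrudgian2021BAMS, Theorem 1 and Corollary 1] -/
theorem BrentPlattTrudgian2021BAMS_thm1_iff :
    BrentPlattTrudgian2021BAMS_thm1 ↔ |zetaZeroHarmonicLimit - BPT2021.H| ≤ 1e-18 := by
  constructor
  · rintro ⟨H, hH, hlim⟩
    have := tendsto_nhds_unique hlim BrentPlattTrudgian2021BAMS_thm1_tendsto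
    rw [← this]
    exact hH
  · intro h
    exact ⟨zetaZeroHarmonicLimit, h, BrentPlattTrudgian2021BAMS_thm1_tendsto⟩

/-- **Brent–Platt–Trudgian 2021 (BAMS), Lemma 1**: for `T ≥ 2π`,
`∫_{2π}^T Q(t)/t² dt = Σ_{0<γ≤T} 1/γ − Q(T)/T + 1/(16π) − log²(T/2π)/(4π)` (eq. (2.4) rearranged;
the right-continuous `N` gives the same identity at the ordinates). [cite: BrentPlattTrudgian2021BAMS, Lemma 1] -/
theorem BrentPlattTrudgian2021BAMS_lemma1 {T : ℝ} (hT : 2 * π ≤ T) :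
    ∫ t in (2 * π)..T, ((zetaZeroCount t : ℝ) - countMain t) / t ^ 2 =
      ∑ ρ ∈ zerosBetween 0 T, (riemannZetaZeroOrder ρ : ℝ) / ρ.im
        - ((zetaZeroCount T : ℝ) - countMain T) / T + 1 / (16 * π)
        - Real.log (T / (2 * π)) ^ 2 / (4 * π) := by
  have hπ : 3 < π := Real.pi_gt_three
  have h0 : (0 : ℝ) < 2 * π := by positivity
  have hφ : ∀ t ∈ Icc (2 * π) T, HasDerivAt (fun s : ℝ ↦ 1 / s) (-1 / t ^ 2) t :=
    fun t ht ↦ BPT2021.hasDerivAt_one_div h0 t ht.1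
  have hφ' : ContinuousOn (fun t : ℝ ↦ -1 / t ^ 2) (Icc (2 * π) T) :=
    (BPT2021.continuousOn_neg_one_div_sq h0).mono Icc_subset_Ici_self
  have h := lehman_identity h0 hT hφ hφ'
  rw [integral_inv_mul_log h0 hT, div_self h0.ne', Real.log_one, BPT2021.count_sub_countMain_two_pi,
    ← BPT2021.sum_zerosBetween_zero_eq hT] at h
  have e1 : ∫ t in (2 * π)..T, ((zetaZeroCount t : ℝ) - countMain t) * (-1 / t ^ 2) =
      -∫ t in (2 * π)..T, ((zetaZeroCount t : ℝ) - countMain t) / t ^ 2 := by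
    rw [← intervalIntegral.integral_neg]
    exact intervalIntegral.integral_congr fun t _ ↦ by ring
  have e2 : ∑ ρ ∈ zerosBetween 0 T, (riemannZetaZeroOrder ρ : ℝ) * (1 / ρ.im) =
      ∑ ρ ∈ zerosBetween 0 T, (riemannZetaZeroOrder ρ : ℝ) / ρ.im :=
    Finset.sum_congr rfl fun ρ _ ↦ by rw [mul_one_div]
  rw [e1, e2] at h
  have hT0 : 0 < T := by linarith
  have e3 : ((zetaZeroCount T : ℝ) - countMain T) * (1 / T) = ((zetaZeroCount T : ℝ) - countMain T) / T := by
    rw [mul_one_div]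
  rw [e3] at h
  have e4 : (Real.log (T / (2 * π)) ^ 2 - 0 ^ 2) / 2 / (2 * π) = Real.log (T / (2 * π)) ^ 2 / (4 * π) := by
    field_simp; ring
  rw [e4] at h
  have e5 : (1 / 8 : ℝ) * (1 / (2 * π)) = 1 / (16 * π) := by
    field_simp; norm_num
  rw [e5] at h
  linarith

/-- **Brent–Platt–Trudgian 2021 (BAMS), Theorem 2 — the accelerated formula (2.11) as an exact
identity**: for every `T ≥ 2π`,
`H = Σ_{0<γ≤T} (1/γ − 1/T) − (log²(T/2πe) + 1)/(4π) + 7/(8T) + E₂(T)`, `E₂(T) = ∫_T^∞ Q(t)/t² dt`.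
[cite: BrentPlattTrudgian2021BAMS, Theorem 2 eq. (2.11)] -/
theorem BrentPlattTrudgian2021BAMS_thm2_eq {T : ℝ} (hT : 2 * π ≤ T) :
    zetaZeroHarmonicLimit =
      ∑ ρ ∈ zerosBetween 0 T, (riemannZetaZeroOrder ρ : ℝ) * (1 / ρ.im - 1 / T)
        - (Real.log (T / (2 * π * Real.exp 1)) ^ 2 + 1) / (4 * π) + 7 / (8 * T)
        + ∫ t in Ioi T, ((zetaZeroCount t : ℝ) - countMain t) / t ^ 2 := by
  have hπ : 3 < π := Real.pi_gt_three
  have h0 : (0 : ℝ) < 2 * π := by positivity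
  have h2 : (3 : ℝ) ≤ 2 * π := by linarith
  have hT0 : 0 < T := by linarith
  -- `∫_{2π}^∞ = ∫_{2π}^T + ∫_T^∞` and Lemma 1
  have hsplit := intervalIntegral.integral_Ioi_sub_Ioi (integrableOn_count_sub_countMain_div_sq h2) hT
  have hL1 := BrentPlattTrudgian2021BAMS_lemma1 hT
  -- `N(T) = Σ_{0<γ≤T} m(ρ)`
  have hN : (zetaZeroCount T : ℝ) = ∑ ρ ∈ zerosBetween 0 T, (riemannZetaZeroOrder ρ : ℝ) := by
    have h := zetaZeroCount_sub_eq_sum (T₁ := 0) (T₂ := T) hT0.le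
    rw [zetaZeroCount_eq_zero_of_nonpos le_rfl, Nat.cast_zero, sub_zero] at h
    exact h
  have hsum : ∑ ρ ∈ zerosBetween 0 T, (riemannZetaZeroOrder ρ : ℝ) * (1 / ρ.im - 1 / T) =
      ∑ ρ ∈ zerosBetween 0 T, (riemannZetaZeroOrder ρ : ℝ) / ρ.im - (zetaZeroCount T : ℝ) / T := by
    rw [hN, Finset.sum_div, ← Finset.sum_sub_distrib]
    exact Finset.sum_congr rfl fun ρ _ ↦ by ring
  have hlog : Real.log (T / (2 * π * Real.exp 1)) = Real.log (T / (2 * π)) - 1 := by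
    rw [show T / (2 * π * Real.exp 1) = T / (2 * π) / Real.exp 1 by ring,
      Real.log_div (by positivity) (Real.exp_pos 1).ne', Real.log_exp]
  have hH : zetaZeroHarmonicLimit =
      (∫ t in (2 * π)..T, ((zetaZeroCount t : ℝ) - countMain t) / t ^ 2)
        + (∫ t in Ioi T, ((zetaZeroCount t : ℝ) - countMain t) / t ^ 2) - 1 / (16 * π) := by
    rw [zetaZeroHarmonicLimit]
    linarith
  rw [hsum, hlog, hH, hL1, countMain]
  field_simp
  ring


/-! ## Bounds for `E₂(T) = ∫_T^∞ Q(t)/t² dt` and Theorem 2 of the BAMS paper -/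

/-- **Brent–Platt–Trudgian 2021 (BAMS), Lemma 2 / Theorem 2, the printed bound**: for `T ≥ 2π`,
`|E₂(T)| = |∫_T^∞ Q/t²| ≤ (4.27 + 0.12 log T)/T²`, GIVEN the two named facts of
`ZetaZeroSumsLehmanExplicit.lean` that the source uses: the standing condition (2.9) on `[2π,∞)`
(`h29 : BrentPlattTrudgian2021_eq29`, Trudgian's `A₀ = 2.067`, `A₁ = 0.059`) and Lemma 2 of the
Math. Comp. paper (`hL2 : BrentPlattTrudgian2021_lemma2`, `A₂ = 1/150`; the source itself uses
Trudgian 2014's `0.2/T`, giving the same printed constants). From (1.3):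
`2(2.067 + 0.059 log T)/T² + (0.059 + 1/150)/T² ≤ (4.27 + 0.12 log T)/T²`.
[cite: BrentPlattTrudgian2021BAMS, Lemma 2] -/
theorem BrentPlattTrudgian2021BAMS_lemma2 (h29 : BrentPlattTrudgian2021_eq29)
    (hL2 : BrentPlattTrudgian2021_lemma2) {T : ℝ} (hT : 2 * π ≤ T) :
    |∫ t in Ioi T, ((zetaZeroCount t : ℝ) - countMain t) / t ^ 2| ≤
      (4.27 + 0.12 * Real.log T) / T ^ 2 := by
  have hπ : 3 < π := Real.pi_gt_three
  have hT0 : 0 < T := by linarith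
  have h2 : (3 : ℝ) ≤ T := by linarith
  have hlogT : 0 ≤ Real.log T := Real.log_nonneg (by linarith)
  have hS1 : ∀ t ∈ Ici T, |∫ x in (168 * π)..t, zetaArgS x| ≤ 2.067 + 0.059 * Real.log t :=
    fun t ht ↦ h29 t (hT.trans ht)
  have hQS : ∀ t ∈ Ici T, |((zetaZeroCount t : ℝ) - countMain t) - zetaArgS t| ≤ (1 / 150) / t := by
    intro t ht
    have h := hL2 t (hT.trans ht)
    rwa [div_div]
  have h := BrentPlattTrudgian2021_thm1_E2 h2 (by norm_num : (0 : ℝ) ≤ 0.059)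
    (BPT2021.hasDerivAt_one_div hT0) (BPT2021.hasDerivAt_neg_one_div_sq hT0)
    (BPT2021.continuousOn_two_div_cube hT0) (fun t ht ↦ by have := hT0.trans_le ht; positivity)
    (fun t ht ↦ by
      have := hT0.trans_le ht
      exact div_nonpos_of_nonpos_of_nonneg (by norm_num) (by positivity))
    (fun t ht ↦ by have := hT0.trans_le ht; positivity) (BPT2021.integrableOn_one_div_div hT0) hS1 hQS
  rw [BPT2021.integral_Ioi_mul_neg_one_div_sq, abs_neg] at h
  have e1 : |(-1 : ℝ) / T ^ 2| = 1 / T ^ 2 := by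
    rw [neg_div, abs_neg, abs_of_pos (by positivity)]
  rw [e1] at h
  refine h.trans ?_
  rw [show 2 * (2.067 + 0.059 * Real.log T) * (1 / T ^ 2) + (0.059 + 1 / 150) * (1 / T) / T =
      (2 * (2.067 + 0.059 * Real.log T) + (0.059 + 1 / 150)) / T ^ 2 by field_simp]
  apply div_le_div_of_nonneg_right _ (by positivity)
  linarith

/-- **Brent–Platt–Trudgian 2021 (BAMS), Theorem 2, as printed**: "For all `T ≥ 2π`,
`H = Σ_{0<γ≤T} (1/γ − 1/T) − (log²(T/2πe) + 1)/(4π) + 7/(8T) + E₂(T)`, where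
`|E₂(T)| ≤ (4.27 + 0.12 log T)/T²`" — modulo the two named facts behind the printed `E₂`
bound (see `BrentPlattTrudgian2021BAMS_lemma2`); the identity itself is the theorem
`BrentPlattTrudgian2021BAMS_thm2_eq`. [cite: BrentPlattTrudgian2021BAMS, Theorem 2] -/
theorem BrentPlattTrudgian2021BAMS_thm2 (h29 : BrentPlattTrudgian2021_eq29)
    (hL2 : BrentPlattTrudgian2021_lemma2) {T : ℝ} (hT : 2 * π ≤ T) :
    |zetaZeroHarmonicLimit
        - (∑ ρ ∈ zerosBetween 0 T, (riemannZetaZeroOrder ρ : ℝ) * (1 / ρ.im - 1 / T)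
          - (Real.log (T / (2 * π * Real.exp 1)) ^ 2 + 1) / (4 * π) + 7 / (8 * T))| ≤
      (4.27 + 0.12 * Real.log T) / T ^ 2 := by
  rw [BrentPlattTrudgian2021BAMS_thm2_eq hT, add_sub_cancel_left]
  exact BrentPlattTrudgian2021BAMS_lemma2 h29 hL2 hT

/-! ## The simple truncation (2.10): `H = Σ_{0<γ≤T} 1/γ − log²(T/2π)/(4π) + Aϑ(2 log T + 1)/T` -/

/-- **Brent–Platt–Trudgian 2021 (BAMS), eq. (2.10)** (Lehman's lemma with `T₂ = ∞`): if
`|N(t) − L(t)| ≤ A log t` for all `t ≥ 2π`, then for every `T ≥ 2π`,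
`|Σ_{0<γ≤T} m(ρ)/γ − log²(T/2π)/(4π) − H| ≤ A(2 log T + 1)/T`
(`H − (G(T) − log²/4π) = −Q(T)/T + ∫_T^∞ Q/t²`, `|Q(T)| ≤ A log T`,
`|∫_T^∞ Q/t²| ≤ A log T/T + A/T`). The source states it for `T ≥ 2πe` with `A = 0.28`.
[cite: BrentPlattTrudgian2021BAMS, §4 eq. (2.10)] -/
theorem abs_sum_inv_ordinate_sub_log_sq_sub_harmonicLimit_le_of_count {A T : ℝ}
    (hA : ∀ t : ℝ, 2 * π ≤ t → |(zetaZeroCount t : ℝ) - countMain t| ≤ A * Real.log t)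
    (hT : 2 * π ≤ T) :
    |∑ ρ ∈ zerosBetween 0 T, (riemannZetaZeroOrder ρ : ℝ) / ρ.im
        - Real.log (T / (2 * π)) ^ 2 / (4 * π) - zetaZeroHarmonicLimit| ≤
      A * (2 * Real.log T + 1) / T := by
  have hπ : 3 < π := Real.pi_gt_three
  have h0 : (0 : ℝ) < 2 * π := by positivity
  have h2 : (3 : ℝ) ≤ 2 * π := by linarith
  have hT0 : 0 < T := by linarith
  have hT2 : (3 : ℝ) ≤ T := by linarith
  have hlogT : 0 < Real.log T := Real.log_pos (by linarith)
  have hA0 : 0 ≤ A := by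
    have h1' := hA T hT
    have : 0 ≤ A * Real.log T := (abs_nonneg _).trans h1'
    nlinarith
  -- `H − (G − log²/4π) = −Q(T)/T + ∫_T^∞ Q/t²`
  have hsplit := intervalIntegral.integral_Ioi_sub_Ioi (integrableOn_count_sub_countMain_div_sq h2) hT
  have hL1 := BrentPlattTrudgian2021BAMS_lemma1 hT
  have hkey : ∑ ρ ∈ zerosBetween 0 T, (riemannZetaZeroOrder ρ : ℝ) / ρ.im
      - Real.log (T / (2 * π)) ^ 2 / (4 * π) - zetaZeroHarmonicLimit =
      ((zetaZeroCount T : ℝ) - countMain T) / T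
        - ∫ t in Ioi T, ((zetaZeroCount t : ℝ) - countMain t) / t ^ 2 := by
    rw [zetaZeroHarmonicLimit]
    linarith
  -- the two pieces
  have hQT : |((zetaZeroCount T : ℝ) - countMain T) / T| ≤ A * Real.log T / T := by
    rw [abs_div, abs_of_pos hT0]
    exact div_le_div_of_nonneg_right (hA T hT) hT0.le
  have hE : |∫ t in Ioi T, ((zetaZeroCount t : ℝ) - countMain t) / t ^ 2| ≤
      A * Real.log T / T + A / T := by
    have hQ : ∀ t : ℝ, T ≤ t → |(zetaZeroCount t : ℝ) - countMain t| ≤ A * Real.log t + 0 := by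
      intro t ht
      rw [add_zero]
      exact hA t (hT.trans ht)
    have h := BPT2021.abs_integral_Ioi_count_sub_countMain_mul_deriv_le hT2 hA0 le_rfl hQ
      (BPT2021.hasDerivAt_one_div hT0) (BPT2021.continuousOn_neg_one_div_sq hT0)
      (fun t ht ↦ by have := hT0.trans_le ht; positivity)
      (fun t ht ↦ by
        have := hT0.trans_le ht
        exact div_nonpos_of_nonpos_of_nonneg (by norm_num) (by positivity))
      (BPT2021.integrableOn_one_div_div hT0)
    rw [BPT2021.integral_Ioi_mul_neg_one_div_sq, abs_neg, BPT2021.integral_Ioi_one_div_div hT0,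
      add_zero] at h
    refine h.trans (le_of_eq ?_)
    field_simp
  rw [hkey]
  calc |((zetaZeroCount T : ℝ) - countMain T) / T
          - ∫ t in Ioi T, ((zetaZeroCount t : ℝ) - countMain t) / t ^ 2|
      ≤ |((zetaZeroCount T : ℝ) - countMain T) / T|
          + |∫ t in Ioi T, ((zetaZeroCount t : ℝ) - countMain t) / t ^ 2| := abs_sub _ _
    _ ≤ A * Real.log T / T + (A * Real.log T / T + A / T) := add_le_add hQT hE
    _ = A * (2 * Real.log T + 1) / T := by
        field_simp
        ring

/-- **Eq. (2.10) as printed, `A = 0.28`** (Brent–Platt–Trudgian 2022, Cor. 1 = the named fact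
`BrentPlattTrudgian2022_cor1`): for every `T ≥ 2π`,
`|Σ_{0<γ≤T} m(ρ)/γ − log²(T/2π)/(4π) − H| ≤ 0.28(2 log T + 1)/T`.
[cite: BrentPlattTrudgian2021BAMS, §4 eq. (2.10)] [cite: BrentPlattTrudgian2022, Cor. 1] -/
theorem BrentPlattTrudgian2022_cor1.abs_sum_inv_sub_log_sq_sub_harmonicLimit_le
    (h : BrentPlattTrudgian2022_cor1) {T : ℝ} (hT : 2 * π ≤ T) :
    |∑ ρ ∈ zerosBetween 0 T, (riemannZetaZeroOrder ρ : ℝ) / ρ.im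
        - Real.log (T / (2 * π)) ^ 2 / (4 * π) - zetaZeroHarmonicLimit| ≤
      0.28 * (2 * Real.log T + 1) / T :=
  abs_sum_inv_ordinate_sub_log_sq_sub_harmonicLimit_le_of_count h hT

/-- **The harmonic sum to `18 + O(log T/T)` digits**: with the value of `H`
(`BrentPlattTrudgian2021BAMS_thm1`) and `A = 0.28` (`BrentPlattTrudgian2022_cor1`), for `T ≥ 2π`,
`|Σ_{0<γ≤T} m(ρ)/γ − log²(T/2π)/(4π) − (−0.0171594043070981495)| ≤ 10⁻¹⁸ + 0.28(2 log T + 1)/T`.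
[cite: BrentPlattTrudgian2021BAMS, Corollary 1 and §4 eq. (2.10)] -/
theorem BrentPlattTrudgian2021BAMS_thm1.abs_sum_inv_sub_log_sq_sub_H_le
    (hH : BrentPlattTrudgian2021BAMS_thm1) (hc : BrentPlattTrudgian2022_cor1) {T : ℝ}
    (hT : 2 * π ≤ T) :
    |∑ ρ ∈ zerosBetween 0 T, (riemannZetaZeroOrder ρ : ℝ) / ρ.im
        - Real.log (T / (2 * π)) ^ 2 / (4 * π) - BPT2021.H| ≤
      1e-18 + 0.28 * (2 * Real.log T + 1) / T := by
  have h1 := BrentPlattTrudgian2021BAMS_thm1_iff.1 hH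
  have h2 := BrentPlattTrudgian2022_cor1.abs_sum_inv_sub_log_sq_sub_harmonicLimit_le hc hT
  have e : ∑ ρ ∈ zerosBetween 0 T, (riemannZetaZeroOrder ρ : ℝ) / ρ.im
        - Real.log (T / (2 * π)) ^ 2 / (4 * π) - BPT2021.H =
      (zetaZeroHarmonicLimit - BPT2021.H)
        + (∑ ρ ∈ zerosBetween 0 T, (riemannZetaZeroOrder ρ : ℝ) / ρ.im
          - Real.log (T / (2 * π)) ^ 2 / (4 * π) - zetaZeroHarmonicLimit) := by ring
  rw [e]
  exact (abs_add_le _ _).trans (add_le_add h1 h2)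

end Literature.NumberTheory.LFunctions
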